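import Summits.BirchSwinnertonDyer.BirchSwinnertonDyer.Theorems.ManinLocalTwoThreeEtaBasisFortyFiveA
import Summits.BirchSwinnertonDyer.BirchSwinnertonDyer.Theorems.ManinLocalTwoThreeOldformsSixty
import HarnessLib

/-!
# Level 45 (C3 domain, genus 3), part 5b: the OLD forms `ι₁φ₁₅`, `ι₃φ₁₅` of `S₂(Γ₀(45))` and their pivot coefficients

Cell `bsd-f2-manin`, route `ManinLocalTwoThree`, crux C3 `ManinPrimeToThreeAtNine` (stmt-BirchSwinnertonDyer-22968: `3² ∣ 45`), prover seat p2 gen 28;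
`--supports` (helper).  `φ₁₅ = η₁η₃η₅η₁₅` (tree `cuspFormEta15`), its two degeneracy lifts to level `45` (`S₂(Γ₀(45))^old = ⟨ι₁φ₁₅, ι₃φ₁₅⟩`,
`S₂(Γ₀(9)) = S₂(Γ₀(5)) = S₂(Γ₀(3)) = 0`), their membership in `oldSubspace0 45 2`, their `q`-expansions through `q¹⁵` (`QRemainder` calculus on
`qE₁E₃E₅E₁₅` and `3q³E₃E₉E₁₅E₄₅`) and their `cuspCoeff`s at the ten pivots `1,2,3,4,5,6,8,9,10,15` of the `M₂(Γ₀(45))` basis; hence the pivot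
vector `(1, −1, 0, −1, 1, 0, 3, 0, −1, 0)` of the `3`-DEPLETED old form `ι₁φ₁₅ + ⅓ι₃φ₁₅` — the second solution of the curve-side exclusion
(`…CurveExclusionFortyFive`), killed in part 6 by `old ⊓ new = ⊥`.  Nothing here proves C3, Manin's conjecture or BSD.
[cite: AtkinLehner1970, §2] [cite: Koehler2011, §2.1]
-/

set_option autoImplicit false
-- lint-debt: the directory name repeats the summit name (sibling precedent `ManinLocalTwoThreeOldFormsFortyFour.lean`)
set_option linter.dupNamespace false

noncomputable section

open Complex Filter Topology Polynomial
open UpperHalfPlane hiding I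
open scoped Real Topology Manifold MatrixGroups ModularForm
open CongruenceSubgroup
open Literature.NumberTheory.ModularForms
open Literature.NumberTheory.EllipticCurves Literature.NumberTheory.EllipticCurves.ModularForms

namespace Summit.BirchSwinnertonDyer.BirchSwinnertonDyer.Theorems.ManinLocalTwoThree.LevelFortyFive

open QRemainder EulerRemainders EulerRemaindersTwenty LevelFortyFour NoNewformSixty CuspCoeffAsymptotics

/-- `ι_d φ₁₅ ∈ S₂(Γ₀(45))^old` for `d = 1, 3`. [cite: AtkinLehner1970, §2] -/
theorem iota_phi15_mem_old (d : ℕ) [NeZero d] (hd : d = 1 ∨ d = 3) :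
    degeneracyMap0 15 45 d 2 cuspFormEta15 ∈ oldSubspace0 45 2 := by
  have hidx : (15, d) ∈ {x : ℕ × ℕ | x.1 ∈ Nat.properDivisors 45 ∧ x.1 * x.2 ∣ 45} := by
    rcases hd with rfl | rfl <;> decide
  rw [oldSubspace0]
  exact Submodule.mem_iSup_of_mem ⟨(15, d), hidx⟩ (LinearMap.mem_range_self _ _)

/-- **`ι₁φ₁₅ = qE₁E₃E₅E₁₅ = X - X ^ 2 - X ^ 3 - X ^ 4 + X ^ 5 + X ^ 6 + 3 * X ^ 8 + X ^ 9 - X ^ 10 - 4 * X ^ 11 + X ^ 12 - 2 * X ^ 13 - X ^ 15 + o(q¹⁵)`.** [cite: Koehler2011, §2.1] -/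
theorem tendsto_iota1_phi15 :
    Tendsto (fun τ : ℍ ↦ (degeneracyMap0 15 45 1 2 cuspFormEta15 τ - (X - X ^ 2 - X ^ 3 - X ^ 4 + X ^ 5 + X ^ 6 + 3 * X ^ 8 + X ^ 9 - X ^ 10 - 4 * X ^ 11 + X ^ 12 - 2 * X ^ 13 - X ^ 15 : ℂ[X]).eval (Function.Periodic.qParam 1 (τ : ℂ)))
      / Function.Periodic.qParam 1 (τ : ℂ) ^ 15) atImInfty (𝓝 0) := by
  have h1 := EulerRemaindersTwenty.tendsto_mono (show 15 ≤ 33 by norm_num) LevelFortyFour.tendsto_eulerFn_one_thirtyThree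
  have h2 := EulerRemaindersTwenty.tendsto_mono (show 15 ≤ 33 by norm_num) LevelFortyFive.tendsto_eulerFn_three_thirtyThree
  have h3 := QRemainder.reduce (1 - X - X ^ 2 - X ^ 3 + X ^ 4 + 2 * X ^ 5 - X ^ 6 + 2 * X ^ 7 - X ^ 10 - X ^ 11 - X ^ 12 - X ^ 13 + X ^ 15) (-1 - X + 2 * X ^ 2 + X ^ 4 + 2 * X ^ 5 + X ^ 6 - X ^ 7 - X ^ 9 + 2 * X ^ 10 - X ^ 11 - X ^ 13 - X ^ 14 - X ^ 16 - X ^ 17 - X ^ 20 + X ^ 21 + X ^ 25 + X ^ 27 + X ^ 31 : ℂ[X]) (by ring) (QRemainder.mul h1 h2)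
  have h4 := EulerRemaindersTwenty.tendsto_mono (show 15 ≤ 33 by norm_num) LevelFortyFive.tendsto_eulerFn_five_thirtyThree
  have h5 := QRemainder.reduce (1 - X - X ^ 2 - X ^ 3 + X ^ 4 + X ^ 5 + 3 * X ^ 7 + X ^ 8 - X ^ 9 - 4 * X ^ 10 + X ^ 11 - 2 * X ^ 12 - X ^ 14) (2 - X + X ^ 2 + X ^ 5 + X ^ 6 + X ^ 7 - X ^ 10 - X ^ 11 - X ^ 12 + X ^ 13 + 2 * X ^ 14 - X ^ 15 + 2 * X ^ 16 - X ^ 19 - X ^ 20 - X ^ 21 - X ^ 22 + X ^ 24 : ℂ[X]) (by ring) (QRemainder.mul h3 h4)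
  have h6 := EulerRemaindersTwenty.tendsto_mono (show 15 ≤ 33 by norm_num) LevelFortyFive.tendsto_eulerFn_fifteen_thirtyThree
  have h7 := QRemainder.reduce (1 - X - X ^ 2 - X ^ 3 + X ^ 4 + X ^ 5 + 3 * X ^ 7 + X ^ 8 - X ^ 9 - 4 * X ^ 10 + X ^ 11 - 2 * X ^ 12 - X ^ 14 - X ^ 15) (1 + X + X ^ 2 - X ^ 3 - X ^ 4 - 3 * X ^ 6 - X ^ 7 + X ^ 8 + 4 * X ^ 9 - X ^ 10 + 2 * X ^ 11 + X ^ 13 - X ^ 14 + X ^ 15 + X ^ 16 + X ^ 17 - X ^ 18 - X ^ 19 - 3 * X ^ 21 - X ^ 22 + X ^ 23 + 4 * X ^ 24 - X ^ 25 + 2 * X ^ 26 + X ^ 28 : ℂ[X]) (by ring) (QRemainder.mul h5 h6)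
  have h8 := QRemainder.reduce (X - X ^ 2 - X ^ 3 - X ^ 4 + X ^ 5 + X ^ 6 + 3 * X ^ 8 + X ^ 9 - X ^ 10 - 4 * X ^ 11 + X ^ 12 - 2 * X ^ 13 - X ^ 15) (-1 : ℂ[X]) (by ring) (QRemainder.qParam_pow_mul 1 h7)
  have hfin := QRemainder.congr_poly (P' := (X - X ^ 2 - X ^ 3 - X ^ 4 + X ^ 5 + X ^ 6 + 3 * X ^ 8 + X ^ 9 - X ^ 10 - 4 * X ^ 11 + X ^ 12 - 2 * X ^ 13 - X ^ 15 : ℂ[X])) (by ring) h8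
  refine QRemainder.congr_fun (fun τ ↦ ?_) hfin
  rw [congr_fun (coe_degeneracyMap0_one 15 45 2 (by norm_num) cuspFormEta15) τ, f15_eq]
  ring

/-- **`ι₃φ₁₅ = 3q³E₃E₉E₁₅E₄₅ = 3 * X ^ 3 - 3 * X ^ 6 - 3 * X ^ 9 - 3 * X ^ 12 + 3 * X ^ 15 + o(q¹⁵)`.** [cite: Koehler2011, §2.1] -/
theorem tendsto_iota3_phi15 :
    Tendsto (fun τ : ℍ ↦ (degeneracyMap0 15 45 3 2 cuspFormEta15 τ - (3 * X ^ 3 - 3 * X ^ 6 - 3 * X ^ 9 - 3 * X ^ 12 + 3 * X ^ 15 : ℂ[X]).eval (Function.Periodic.qParam 1 (τ : ℂ)))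
      / Function.Periodic.qParam 1 (τ : ℂ) ^ 15) atImInfty (𝓝 0) := by
  have g1 := EulerRemaindersTwenty.tendsto_mono (show 15 ≤ 33 by norm_num) LevelFortyFive.tendsto_eulerFn_three_thirtyThree
  have g2 := EulerRemaindersTwenty.tendsto_mono (show 15 ≤ 33 by norm_num) LevelFortyFive.tendsto_eulerFn_nine_thirtyThree
  have g3 := QRemainder.reduce (1 - X ^ 3 - X ^ 6 - X ^ 9 + X ^ 12 + 2 * X ^ 15) (-X ^ 2 + 2 * X ^ 5 - X ^ 14 - X ^ 17 - X ^ 23 : ℂ[X]) (by ring) (QRemainder.mul g1 g2)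
  have g4 := EulerRemaindersTwenty.tendsto_mono (show 15 ≤ 33 by norm_num) LevelFortyFive.tendsto_eulerFn_fifteen_thirtyThree
  have g5 := QRemainder.reduce (1 - X ^ 3 - X ^ 6 - X ^ 9 + X ^ 12 + X ^ 15) (X ^ 2 + X ^ 5 + X ^ 8 - X ^ 11 - 3 * X ^ 14 + X ^ 17 + X ^ 20 + X ^ 23 - X ^ 26 - 2 * X ^ 29 : ℂ[X]) (by ring) (QRemainder.mul g3 g4)
  have g6 := tendsto_eulerFn (δ := 45) (m := 15) (by norm_num)
  have g7 := QRemainder.mul g5 g6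
  have g8 := QRemainder.reduce (X ^ 3 - X ^ 6 - X ^ 9 - X ^ 12 + X ^ 15) (X ^ 2 : ℂ[X]) (by ring) (QRemainder.qParam_pow_mul 3 g7)
  have gfin := QRemainder.congr_poly (P' := (X ^ 3 - X ^ 6 - X ^ 9 - X ^ 12 + X ^ 15 : ℂ[X])) (by ring) g8
  have h3 := QRemainder.const_mul (3 : ℂ) gfin
  refine QRemainder.congr_fun (fun τ ↦ ?_) (congr_poly (P' := (3 * X ^ 3 - 3 * X ^ 6 - 3 * X ^ 9 - 3 * X ^ 12 + 3 * X ^ 15 : ℂ[X])) (by simp only [map_ofNat]; ring) h3)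
  rw [degeneracyMap0_apply 3 (by norm_num) cuspFormEta15, f15_eq, qParam_tpD, eulerFn_tpD, eulerFn_tpD, eulerFn_tpD, eulerFn_tpD]
  push_cast
  ring

/-- **The pivot coefficients of `ι₁φ₁₅` and `ι₃φ₁₅`** (`n = 1,2,3,4,5,6,8,9,10,15`). [cite: CremonaAlgorithms1997, Table 3 (N = 15)] -/
theorem cuspCoeff_iota_phi15 :
    (cuspCoeff (degeneracyMap0 15 45 1 2 cuspFormEta15) 1 = 1 ∧
    cuspCoeff (degeneracyMap0 15 45 1 2 cuspFormEta15) 2 = -1 ∧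
    cuspCoeff (degeneracyMap0 15 45 1 2 cuspFormEta15) 3 = -1 ∧
    cuspCoeff (degeneracyMap0 15 45 1 2 cuspFormEta15) 4 = -1 ∧
    cuspCoeff (degeneracyMap0 15 45 1 2 cuspFormEta15) 5 = 1 ∧
    cuspCoeff (degeneracyMap0 15 45 1 2 cuspFormEta15) 6 = 1 ∧
    cuspCoeff (degeneracyMap0 15 45 1 2 cuspFormEta15) 8 = 3 ∧
    cuspCoeff (degeneracyMap0 15 45 1 2 cuspFormEta15) 9 = 1 ∧
    cuspCoeff (degeneracyMap0 15 45 1 2 cuspFormEta15) 10 = -1 ∧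
    cuspCoeff (degeneracyMap0 15 45 1 2 cuspFormEta15) 15 = -1) ∧
    (cuspCoeff (degeneracyMap0 15 45 3 2 cuspFormEta15) 1 = 0 ∧
    cuspCoeff (degeneracyMap0 15 45 3 2 cuspFormEta15) 2 = 0 ∧
    cuspCoeff (degeneracyMap0 15 45 3 2 cuspFormEta15) 3 = 3 ∧
    cuspCoeff (degeneracyMap0 15 45 3 2 cuspFormEta15) 4 = 0 ∧
    cuspCoeff (degeneracyMap0 15 45 3 2 cuspFormEta15) 5 = 0 ∧
    cuspCoeff (degeneracyMap0 15 45 3 2 cuspFormEta15) 6 = -3 ∧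
    cuspCoeff (degeneracyMap0 15 45 3 2 cuspFormEta15) 8 = 0 ∧
    cuspCoeff (degeneracyMap0 15 45 3 2 cuspFormEta15) 9 = -3 ∧
    cuspCoeff (degeneracyMap0 15 45 3 2 cuspFormEta15) 10 = 0 ∧
    cuspCoeff (degeneracyMap0 15 45 3 2 cuspFormEta15) 15 = 3) := by
  have h1 := fun n hn ↦ cuspCoeff_eq_coeff_of_tendsto _ _ 15 (by compute_degree!) tendsto_iota1_phi15 n hn
  have h3 := fun n hn ↦ cuspCoeff_eq_coeff_of_tendsto _ _ 15 (by compute_degree!) tendsto_iota3_phi15 n hn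
  refine ⟨⟨?_, ?_, ?_, ?_, ?_, ?_, ?_, ?_, ?_, ?_⟩, ⟨?_, ?_, ?_, ?_, ?_, ?_, ?_, ?_, ?_, ?_⟩⟩
  all_goals first
    | (rw [h1 _ (by norm_num)]; simp [coeff_X_pow, coeff_X])
    | (rw [h3 _ (by norm_num)]; simp [coeff_X_pow])

/-- **The `3`-depleted old form `G = ι₁φ₁₅ + ⅓ι₃φ₁₅ ∈ S₂(Γ₀(45))^old` and its pivot vector `(1, −1, 0, −1, 1, 0, 3, 0, −1, 0)`.**
[cite: AtkinLehner1970, §2] -/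
theorem oldWitness_fortyFive :
    ∃ G : CuspForm (Gamma0 45) 2, G ∈ oldSubspace0 45 2 ∧
      cuspCoeff G 1 = 1 ∧ cuspCoeff G 2 = -1 ∧ cuspCoeff G 3 = 0 ∧ cuspCoeff G 4 = -1 ∧ cuspCoeff G 5 = 1 ∧ cuspCoeff G 6 = 0 ∧
      cuspCoeff G 8 = 3 ∧ cuspCoeff G 9 = 0 ∧ cuspCoeff G 10 = -1 ∧ cuspCoeff G 15 = 0 := by
  obtain ⟨⟨a1, a2, a3, a4, a5, a6, a8, a9, a10, a15⟩, ⟨b1, b2, b3, b4, b5, b6, b8, b9, b10, b15⟩⟩ := cuspCoeff_iota_phi15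
  refine ⟨degeneracyMap0 15 45 1 2 cuspFormEta15 + (1 / 3 : ℂ) • degeneracyMap0 15 45 3 2 cuspFormEta15,
    Submodule.add_mem _ (iota_phi15_mem_old 1 (Or.inl rfl)) (Submodule.smul_mem _ _ (iota_phi15_mem_old 3 (Or.inr rfl))), ?_⟩
  simp only [cuspCoeff_add_form (one_mem_strictPeriods_coe_gamma0 45), cuspCoeff_smul, a1, a2, a3, a4, a5, a6, a8, a9, a10, a15, b1, b2, b3, b4, b5, b6, b8, b9, b10, b15]
  norm_num

end Summit.BirchSwinnertonDyer.BirchSwinnertonDyer.Theorems.ManinLocalTwoThree.LevelFortyFive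

end
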